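import Literature.NumberTheory.LFunctions.ChebyshevHalfLineBiasCharacters
import HarnessLib

/-!
# GRH-CONDITIONAL (Thms 1.1, 1.3, 1.4; Cor 1.2 proved from Thm 1.1) — RH-FREE literature; «nothing here bears on the truth of RH»
# Chebyshev's bias for the inverse-square-root weighted prime counts, on a set of natural density one (Hayani 2025, triage-typing)

TRIAGE-TYPING of a 2025 preprint, AS PRINTED, with a status note and NO endorsement (RH literature-typing tranche 1
part 2, director-rh 2026-08-26, D-0088(4): a direct 2025 descendant — it cites and continues [Su] = Suzuki, Ramanujan J.
68 (2025), typed in `ChebyshevHalfLineBias{,Variants,Characters}.lean` — of the tranche's named source). Source, read in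
full (held text `paper:arxiv-2512.23302`, 10 pp.):

> M. Hayani, *Chebyshev's bias without linear independence*, arXiv:2512.23302 [math.NT] (v1 29 Dec 2025, v3 25 Jun 2026)
> [bib: `Hayani2025`].

STATUS: PREPRINT, unrefereed; the statements of Thms 1.1, 1.3, 1.4 and Cor 1.2 typed below are word-for-word identical in v1
(the held text) and v3 (checked against the v3 TeX source); v3's abstract records that «the same type of results … were
independently proved by Arshay Sheth (2025) in the general context of automorphic forms». Every printed theorem below is a NAMED FACT `def … : Prop` (D-0014); what is PROVED
here is elementary and is proved from Mathlib: the density bookkeeping the paper uses (its display (1.5): «any Borel set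
`A ⊂ (0,∞)` satisfying `∫₀^∞ 𝟙_A(e^y) dy < ∞` has zero natural density», complements, supersets, discarding a bounded
part), the value `M(4;3,1) = −(1 + 2m_{χ₄})/2` of the bias constant, and the printed deduction Cor 1.2 ⇐ Thm 1.1.

## Dictionary (tree vocabulary; the three new notions are the paper's own)

* (1.1) `π_{1/2}(x;q,a) = Σ_{p ≤ x, p ≡ a (q)} p^{-1/2}` (Aoki–Koyama's weighted prime count) → `primeSumHalf q a x`
  (NEW definition; nothing in the tree counts primes in a class with the weight `p^{-1/2}` — Suzuki's sums of
  `ChebyshevHalfLineBias*.lean` carry `Λ(n) n^{-1/2} log(x/n)`).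
* `r(a) = #{x ∈ (ℤ/qℤ)ˣ : x² = a}` (after (1.3)) → `sqrtCount q a` (NEW; typed as `#{x ∈ ℤ/qℤ : x² = a}`, which is the printed count
  for a unit `a`: a square root of a unit is a unit, `sqrtCount_eq_card_units`).
* `M(q;a,b) = (2φ(q))⁻¹ (r(a) − r(b) + 2 Σ_{χ ≠ χ₀} (χ(a) − χ(b)) m_χ)`, `m_χ = ord_{s=1/2} L(s,χ)` → `biasMean q a b`
  (NEW, complex-valued as printed — it is real, but that is not needed), with `m_χ = DirichletDisc.zeroOrder χ (1/2)`
  (`DirichletLogDerivDisc.lean`, as in the Suzuki typing) and `χ₀ = 1`.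
* «GRH for `χ`» = the tree's open-strip `DirichletCharacter.RiemannHypothesis χ` (`GeneralizedRH.lean`), exactly as in
  `ChebyshevHalfLineBiasCharacters.lean` (encoding (1) there); «the non-principal character modulo 4» =
  `ZMod.χ₄.ringHomComp (Int.castRingHom ℂ)`, as in `Suzuki2025Chebyshev_thm4`.
* «the natural density of the set `P ⊆ [2,∞)` exists and equals `δ`» = `lim_{X→∞} m{2 ≤ x ≤ X : x ∈ P}/X = δ` (§1, first
  display) → `HasRealNatDensity P δ`; «the logarithmic density … equals `δ`» = `lim_{X→∞} (log X)⁻¹ ∫₂^X 𝟙_P(u) du/u = δ`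
  (§1, second display) → `HasRealLogDensity P δ` (NEW; `m` = Lebesgue measure `volume` on `ℝ`; the tree's
  `HasNaturalDensity` of `Literature/Barriers/Parity/LogarithmicAveraging.lean` is for sets of INTEGERS).

## What is here (printed item → declaration → status)

* Thm 1.1 → `Hayani2025_thm1_1` — NAMED FACT (GRH-CONDITIONAL). Cor 1.2 → `Hayani2025_thm1_1.cor1_2` — PROVED from
  Thm 1.1 (no separate fact; the printed deduction: `r(3) = 0 < 2 = r(1)` mod 4, so `M(4;3,1) = −(1 + 2m_{χ₄})/2 < 0`).
  Thm 1.3 → `Hayani2025_thm1_3` — NAMED FACT (GRH-CONDITIONAL; the Deep-Riemann-Hypothesis asymptotic of Aoki–Koyama on a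
  set of density one). Thm 1.4 → `Hayani2025_thm1_4` — NAMED FACT (GRH-CONDITIONAL mean value), DISCHARGED
  2026-08-28: `Hayani2025_thm1_4_holds` (`ChebyshevBiasNaturalDensityMeanProofs.lean`, with
  `ChebyshevBiasMeanValueCesaro.lean` and `ChebyshevBiasMeanValuePrimePowers.lean`).
* (1.5) → `hasRealNatDensity_zero_of_integrableOn_inv` — PROVED; with `HasRealNatDensity.of_superset`,
  `HasRealNatDensity.inter_Ici`, `HasRealNatDensity.compl_of_zero`, `HasRealNatDensity.univ`.
* NOT typed: Thm 3.1 (the class-function version `t : (ℤ/qℤ)ˣ → ℂ`, `⟨t, χ₀⟩ = 0`, of which Thms 1.1/1.4 are the case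
  `t = 𝟙_a − 𝟙_b`) — `-- TODO(general form)`; Lemmas 2.1–2.3 (the uniform `2k`-th moment bound `(𝒞k)^{4k}` after Puchta and
  the explicit-formula plumbing for `Δ(y;t)`), which are steps of the proofs.

Nothing in this file is, or is worded as, progress toward RH or GRH: every fact is an implication FROM GRH.
-/

noncomputable section

open Filter Topology Asymptotics MeasureTheory Set
open scoped Real

namespace Literature.NumberTheory.LFunctions

/-! ## §1 Natural and logarithmic density of a set of reals `x ≥ 2` -/

/-- **Natural density of a set of reals** (§1, first display): «the natural density of the set `P` [of reals `x ≥ 2`] …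
namely the limit `lim_{X→∞} m{2 ≤ x ≤ X : x ∈ P}/X`, where `m` is the Lebesgue measure on `ℝ`» — `HasRealNatDensity P δ`
says that this limit exists and equals `δ`. [cite: Hayani2025, §1 (first display)] -/
def HasRealNatDensity (P : Set ℝ) (δ : ℝ) : Prop :=
  Tendsto (fun X : ℝ => volume.real (P ∩ Icc 2 X) / X) atTop (𝓝 δ)

/-- **Logarithmic density of a set of reals** (§1, second display): «the logarithmic density
`lim_{X→∞} (1/log X) ∫₂^X 𝟙_P(u) du/u` of the set `P`» — `HasRealLogDensity P δ` says that this limit exists and equals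
`δ`. [cite: Hayani2025, §1 (second display)] -/
def HasRealLogDensity (P : Set ℝ) (δ : ℝ) : Prop :=
  Tendsto (fun X : ℝ => (∫ u in Icc 2 X, P.indicator (fun u : ℝ => u⁻¹) u) / Real.log X) atTop (𝓝 δ)

/-! ## §1 The weighted prime count `π_{1/2}`, the square-root count `r`, the bias constant `M(q;a,b)` -/

/-- **Aoki–Koyama's weighted prime counting function** (1.1): `π_{1/2}(x;q,a) = Σ_{p ≤ x, p ≡ a mod q} 1/√p`.
[cite: Hayani2025, §1 eq. (1.1)] -/
def primeSumHalf (q : ℕ) (a : ZMod q) (x : ℝ) : ℝ :=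
  ∑ p ∈ (Finset.Icc 1 ⌊x⌋₊).filter (fun p : ℕ => p.Prime ∧ ((p : ℕ) : ZMod q) = a), 1 / Real.sqrt (p : ℝ)

/-- `r(a) = #{x ∈ (ℤ/qℤ)ˣ : x² = a}` (§1, after (1.3)), typed as the number of ALL `x ∈ ℤ/qℤ` with `x² = a` — the same
number when `a` is a unit (`sqrtCount_eq_card_units`), which is the only case the paper uses.
[cite: Hayani2025, §1 (definition of r, after (1.3))] -/
def sqrtCount (q : ℕ) [NeZero q] (a : ZMod q) : ℕ :=
  (Finset.univ.filter fun x : ZMod q => x ^ 2 = a).card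

/-- **The bias constant** `M(q;a,b) = (1/(2φ(q))) (r(a) − r(b) + 2 Σ_{χ ≠ χ₀} (χ(a) − χ(b)) m_χ)`, where
`m_χ = ord_{s=1/2} L(s,χ)` (§1, after (1.3)); `m_χ = DirichletDisc.zeroOrder χ (1/2)`, `χ₀ = 1`.
[cite: Hayani2025, §1 (display after (1.3))] -/
def biasMean (q : ℕ) [NeZero q] (a b : ZMod q) : ℂ :=
  1 / (2 * (Nat.totient q : ℂ)) *
    ((sqrtCount q a : ℂ) - sqrtCount q b +
      2 * ∑ χ ∈ (Finset.univ : Finset (DirichletCharacter ℂ q)).erase 1,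
        (χ a - χ b) * (DirichletDisc.zeroOrder χ (1 / 2) : ℂ))

/-! ## §1 The main theorems — NAMED FACTS (GRH-CONDITIONAL) -/

/-- NAMED FACT — **Thm 1.1**, AS PRINTED: «Let `q ≥ 3` and assume GRH for all non-principal Dirichlet characters modulo
`q`. Let `ε > 0` and let `a, b` be distinct invertible residue classes modulo `q`. Then there exists a (unique) constant `C`
depending on `q`, `a`, and `b`, such that the natural density of the set
`{x ≥ 2 : |π_{1/2}(x;q,a) − π_{1/2}(x;q,b) + M(q;a,b) log log x − C| ≤ (log log x)^{3+ε}/log x}`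
exists and equals `1`. Furthermore, there exists `K = K(a,b) > 1` such that the logarithmic density of the set
`{x ≥ 2 : |π_{1/2}(x;q,a) − π_{1/2}(x;q,b) + M(q;a,b) log log x − C| ≤ K log log x/log x}` exists and equals `1`.»
Typed with one constant `C ∈ ℂ` for all `ε` (as in the printed Thm 3.1, «there exists a (unique) constant `C = C(t)` such
that for all `ε > 0` …»; `C` is real when it exists, the left-hand side being real — not used), the modulus `|·|` being the
complex norm; uniqueness of `C` is a consequence (two admissible constants differ by at most twice a quantity tending to
`0` along an unbounded set) and is not part of the typed statement. GRH-CONDITIONAL. Users take `(h : Hayani2025_thm1_1)`.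
[cite: Hayani2025, Thm 1.1 (with Thm 3.1)] -/
def Hayani2025_thm1_1 : Prop :=
  ∀ (q : ℕ) [NeZero q], 3 ≤ q → (∀ χ : DirichletCharacter ℂ q, χ ≠ 1 → χ.RiemannHypothesis) →
    ∀ a b : ZMod q, IsUnit a → IsUnit b → a ≠ b →
      ∃ C : ℂ,
        (∀ ε : ℝ, 0 < ε →
          HasRealNatDensity
            {x : ℝ | 2 ≤ x ∧ ‖((primeSumHalf q a x - primeSumHalf q b x : ℝ) : ℂ) +
              biasMean q a b * (Real.log (Real.log x) : ℂ) - C‖ ≤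
                Real.log (Real.log x) ^ (3 + ε) / Real.log x} 1) ∧
        (∃ K : ℝ, 1 < K ∧
          HasRealLogDensity
            {x : ℝ | 2 ≤ x ∧ ‖((primeSumHalf q a x - primeSumHalf q b x : ℝ) : ℂ) +
              biasMean q a b * (Real.log (Real.log x) : ℂ) - C‖ ≤
                K * Real.log (Real.log x) / Real.log x} 1)

/-- NAMED FACT — **Thm 1.3**, AS PRINTED: «Assume GRH for a non-principal Dirichlet character `χ` modulo `q`. Then, there
exists `ℓ_χ ≠ 0` such that, for all `ε > 0`, the natural density of the set
`𝓔_χ := {x ≥ 2 : |(log x)^{m_χ} Π_{p ≤ x} (1 − χ(p)/p^{1/2})⁻¹ − ℓ_χ| ≤ (log log x)^{3+ε}/log x}` exists and equals `1`»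
(so the Deep-Riemann-Hypothesis asymptotic (1.2) of Conrad/Aoki–Koyama holds along a set of natural density one under GRH
alone). `m_χ = DirichletDisc.zeroOrder χ (1/2)`; the product runs over the primes `p ≤ x`. GRH-CONDITIONAL.
Users take `(h : Hayani2025_thm1_3)`. [cite: Hayani2025, Thm 1.3] -/
def Hayani2025_thm1_3 : Prop :=
  ∀ (q : ℕ) [NeZero q] (χ : DirichletCharacter ℂ q), χ ≠ 1 → χ.RiemannHypothesis →
    ∃ ℓ : ℂ, ℓ ≠ 0 ∧ ∀ ε : ℝ, 0 < ε →
      HasRealNatDensity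
        {x : ℝ | 2 ≤ x ∧ ‖(Real.log x : ℂ) ^ (DirichletDisc.zeroOrder χ (1 / 2)) *
            (∏ p ∈ (Finset.Icc 1 ⌊x⌋₊).filter Nat.Prime, (1 - χ (p : ZMod q) / (Real.sqrt (p : ℝ) : ℂ))⁻¹) - ℓ‖ ≤
          Real.log (Real.log x) ^ (3 + ε) / Real.log x} 1

/-- NAMED FACT — **Thm 1.4**, AS PRINTED: «Let `q ≥ 3` and assume GRH for all non-principal Dirichlet characters modulo
`q`. Let `a, b` be distinct invertible residue classes modulo `q`. Then
`(1/x) ∫₂^x (π_{1/2}(u;q,a) − π_{1/2}(u;q,b)) du = −M(q;a,b) log log x + C + O(log log x/log x)`» (with the constant `C`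
of Thm 1.1; typed with its own `∃ C`). GRH-CONDITIONAL. Users take `(h : Hayani2025_thm1_4)`.
KERNEL STATUS (2026-08-28): DISCHARGED — `Hayani2025_thm1_4_holds : Hayani2025_thm1_4`
(`ChebyshevBiasNaturalDensityMeanProofs.lean`), with the error `O(1/log x)`: per character `χ ≠ χ₀` the Cesàro mean of
`Σ_{p ≤ u} χ(p)/√p` is read off the tree's smoothed half-line explicit formula under GRH (Suzuki (4.5)/(4.5'),
`Hayani2025Mean.exists_norm_halfLineSum_add_le_of_GRH_all`) through the exact identity
`(1/x)Σ_{n ≤ x}(a_n/log n)(x − n) = f(x)/log x + ∫₂^x f φ_x` (`Hayani2025Mean.cesaro_of_rieszBound`,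
`ChebyshevBiasMeanValueCesaro.lean`), Mertens II for `χ²` and the `k ≥ 3` tail (`ChebyshevBiasMeanValuePrimePowers.lean`),
then orthogonality and `φ(q)⁻¹ Σ_{χ ≠ χ₀}(χ̄(a) − χ̄(b))(m_χ + ½[χ² = χ₀]) = M(q;a,b)` (`Hayani2025Mean.biasMean_eq_sum`) —
a deviation from the printed route (MV 12.12 + `|∫Δ| ≪ log Y`), recorded there. Feed users `Hayani2025_thm1_4_holds`.
[cite: Hayani2025, Thm 1.4] -/
def Hayani2025_thm1_4 : Prop :=
  ∀ (q : ℕ) [NeZero q], 3 ≤ q → (∀ χ : DirichletCharacter ℂ q, χ ≠ 1 → χ.RiemannHypothesis) →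
    ∀ a b : ZMod q, IsUnit a → IsUnit b → a ≠ b →
      ∃ C : ℂ,
        (fun x : ℝ => ((1 / x * ∫ u in (2 : ℝ)..x, (primeSumHalf q a u - primeSumHalf q b u) : ℝ) : ℂ) +
            biasMean q a b * (Real.log (Real.log x) : ℂ) - C) =O[atTop]
          fun x : ℝ => Real.log (Real.log x) / Real.log x

/-! ## API of the new notions -/

/-- `π_{1/2}(x;q,a) ≥ 0`. [cite: Hayani2025, §1 eq. (1.1)] -/
theorem primeSumHalf_nonneg (q : ℕ) (a : ZMod q) (x : ℝ) : 0 ≤ primeSumHalf q a x :=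
  Finset.sum_nonneg fun p _ => by positivity

/-- For a unit `a`, the typed `r(a) = #{x ∈ ℤ/qℤ : x² = a}` is the printed `#{x ∈ (ℤ/qℤ)ˣ : x² = a}`: a square root of
a unit is a unit. [cite: Hayani2025, §1 (definition of r)] -/
theorem sqrtCount_eq_card_units {q : ℕ} [NeZero q] {a : ZMod q} (ha : IsUnit a) :
    sqrtCount q a = (Finset.univ.filter fun u : (ZMod q)ˣ => (u : ZMod q) ^ 2 = a).card := by
  unfold sqrtCount
  symm
  apply Finset.card_bij (fun (u : (ZMod q)ˣ) _ => (u : ZMod q))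
  · intro u hu
    simp only [Finset.mem_filter, Finset.mem_univ, true_and] at hu ⊢
    exact hu
  · intro u₁ _ u₂ _ h
    exact Units.ext h
  · intro x hx
    simp only [Finset.mem_filter, Finset.mem_univ, true_and] at hx
    have hxu : IsUnit x := by
      have h2 : IsUnit (x * x) := by rw [← sq, hx]; exact ha
      exact isUnit_of_mul_isUnit_left h2
    refine ⟨hxu.unit, ?_, hxu.unit_spec⟩
    simp only [Finset.mem_filter, Finset.mem_univ, true_and, hxu.unit_spec]
    exact hx

/-! ## §1 eq. (1.5) and the density bookkeeping of §3 — PROVED -/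

namespace HasRealNatDensity

/-- `m([2, X])/X → 1`. [cite: Hayani2025, §1 (first display)] -/
theorem tendsto_volume_Icc_div : Tendsto (fun X : ℝ => volume.real (Icc (2 : ℝ) X) / X) atTop (𝓝 1) := by
  have h : Tendsto (fun X : ℝ => 1 - 2 / X) atTop (𝓝 (1 - 0)) :=
    tendsto_const_nhds.sub (tendsto_const_nhds.div_atTop tendsto_id)
  rw [sub_zero] at h
  refine h.congr' ?_
  filter_upwards [eventually_ge_atTop (2 : ℝ)] with X hX
  rw [Real.volume_real_Icc_of_le hX]
  field_simp

/-- The whole line (equivalently the half-line `[2, ∞)`) has natural density `1`. [cite: Hayani2025, §1 (first display)] -/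
theorem univ : HasRealNatDensity (Set.univ : Set ℝ) 1 := by
  unfold HasRealNatDensity
  simp only [Set.univ_inter]
  exact tendsto_volume_Icc_div

/-- A superset of a set of natural density `1` has natural density `1` («the natural density of its complement exists
and equals `1`», §3). [cite: Hayani2025, §3 (proof of Thm 3.1)] -/
theorem of_superset {A B : Set ℝ} (hA : HasRealNatDensity A 1) (hAB : A ⊆ B) : HasRealNatDensity B 1 := by
  refine tendsto_of_tendsto_of_tendsto_of_le_of_le' hA tendsto_volume_Icc_div ?_ ?_
  · filter_upwards [eventually_gt_atTop (0 : ℝ)] with X hX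
    exact div_le_div_of_nonneg_right (measureReal_mono (inter_subset_inter_left _ hAB)
      (measure_ne_top_of_subset inter_subset_right (by simp [Real.volume_Icc]))) hX.le
  · filter_upwards [eventually_gt_atTop (0 : ℝ)] with X hX
    exact div_le_div_of_nonneg_right (measureReal_mono inter_subset_right (by simp [Real.volume_Icc])) hX.le

/-- Discarding a bounded part does not change natural density `1` («contains all sufficiently large values of a set of
natural density `1`», §3, proof of Thm 1.3). [cite: Hayani2025, §3 (proof of Thm 1.3)] -/
theorem inter_Ici {A : Set ℝ} (hA : HasRealNatDensity A 1) (x₁ : ℝ) : HasRealNatDensity (A ∩ Ici x₁) 1 := by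
  have hlow : Tendsto (fun X : ℝ => volume.real (A ∩ Icc 2 X) / X - volume.real (Icc (2 : ℝ) x₁) / X) atTop
      (𝓝 (1 - 0)) :=
    hA.sub (tendsto_const_nhds.div_atTop tendsto_id)
  rw [sub_zero] at hlow
  refine tendsto_of_tendsto_of_tendsto_of_le_of_le' hlow tendsto_volume_Icc_div ?_ ?_
  · filter_upwards [eventually_gt_atTop (0 : ℝ)] with X hX
    rw [← sub_div]
    apply div_le_div_of_nonneg_right _ hX.le
    have hsub : A ∩ Icc 2 X ⊆ (A ∩ Ici x₁ ∩ Icc 2 X) ∪ Icc 2 x₁ := by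
      rintro x ⟨hxA, hx2, hxX⟩
      by_cases h1 : x₁ ≤ x
      · exact Or.inl ⟨⟨hxA, h1⟩, hx2, hxX⟩
      · exact Or.inr ⟨hx2, (not_le.1 h1).le⟩
    have hfin : volume ((A ∩ Ici x₁ ∩ Icc 2 X) ∪ Icc 2 x₁) ≠ ⊤ :=
      (measure_union_lt_top (measure_lt_top_of_subset inter_subset_right (by simp [Real.volume_Icc]))
        (by simp [Real.volume_Icc])).ne
    have := (measureReal_mono hsub hfin).trans (measureReal_union_le _ _)
    linarith
  · filter_upwards [eventually_gt_atTop (0 : ℝ)] with X hX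
    exact div_le_div_of_nonneg_right (measureReal_mono inter_subset_right (by simp [Real.volume_Icc])) hX.le

/-- The complement of a measurable set of natural density `0` has natural density `1` («the natural density of the set
`E` exists and equals `0`. Hence, the natural density of its complement exists and equals `1`», §3).
[cite: Hayani2025, §3 (proof of Thm 3.1)] -/
theorem compl_of_zero {E : Set ℝ} (hE : MeasurableSet E) (h0 : HasRealNatDensity E 0) :
    HasRealNatDensity Eᶜ 1 := by
  have h : Tendsto (fun X : ℝ => volume.real (Icc (2 : ℝ) X) / X - volume.real (E ∩ Icc 2 X) / X) atTop
      (𝓝 (1 - 0)) :=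
    tendsto_volume_Icc_div.sub h0
  rw [sub_zero] at h
  have hfun : (fun X : ℝ => volume.real (Icc (2 : ℝ) X) / X - volume.real (E ∩ Icc 2 X) / X) =
      fun X => volume.real (Eᶜ ∩ Icc 2 X) / X := by
    funext X
    have hsplit := measureReal_inter_add_sdiff (μ := volume) (s := Icc (2 : ℝ) X) hE (by simp [Real.volume_Icc])
    have hset : Eᶜ ∩ Icc 2 X = Icc (2 : ℝ) X \ E := by
      ext u
      simp only [mem_inter_iff, mem_compl_iff, Set.mem_sdiff]
      tauto
    rw [hset, Set.inter_comm E, ← hsplit]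
    ring
  rw [hfun] at h
  exact h

end HasRealNatDensity

/-- **Eq. (1.5), proved**: «any Borel set `A ⊂ (0,∞)` satisfying `∫₀^∞ 𝟙_A(e^y) dy < ∞` has zero natural density» —
here with the hypothesis in the form `∫_{A ∩ [2,∞)} du/u < ∞` (which is `∫_{log 2}^∞ 𝟙_A(e^y) dy` after `u = e^y`; only
`A ∩ [2, ∞)` enters the natural density). Printed proof: for any `𝓛 > 1`,
`limsup X⁻¹ ∫₁^X 𝟙_A ≤ ∫_𝓛^∞ 𝟙_A(u) du/u → 0` (`𝓛 → ∞`). [cite: Hayani2025, §1 eq. (1.5)] -/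
theorem hasRealNatDensity_zero_of_integrableOn_inv {E : Set ℝ} (hE : MeasurableSet E)
    (hint : IntegrableOn (fun u : ℝ => u⁻¹) (E ∩ Ici 2)) : HasRealNatDensity E 0 := by
  -- the tails `T(L) = ∫_{E ∩ [L,∞)} du/u → 0`
  set T : ℝ → ℝ := fun L => ∫ u in E ∩ Ici L, u⁻¹ with hT
  have hTlim : Tendsto T atTop (𝓝 0) := by
    have h := tendsto_setIntegral_of_antitone (μ := volume) (f := fun u : ℝ => u⁻¹)
      (s := fun L : ℝ => E ∩ Ici L) (fun L => hE.inter measurableSet_Ici)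
      (fun L L' hLL' => inter_subset_inter_right _ (Ici_subset_Ici.2 hLL')) ⟨2, hint⟩
    have hempty : (⋂ L : ℝ, E ∩ Ici L) = ∅ := by
      ext u
      simp only [mem_iInter, mem_inter_iff, mem_Ici, mem_empty_iff_false, iff_false, not_forall]
      exact ⟨u + 1, fun h => by linarith [h.2]⟩
    rw [hempty, Measure.restrict_empty, integral_zero_measure] at h
    exact h
  -- the key bound: for `2 ≤ L ≤ X`, `m(E ∩ [2,X])/X ≤ (L − 2)/X + T(L)`
  have hkey : ∀ L X : ℝ, 2 ≤ L → L ≤ X → volume.real (E ∩ Icc 2 X) / X ≤ (L - 2) / X + T L := by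
    intro L X hL hLX
    have hX : 0 < X := by linarith
    have hsub : E ∩ Icc 2 X ⊆ Icc 2 L ∪ (E ∩ Icc L X) := by
      rintro u ⟨huE, hu2, huX⟩
      by_cases h : u ≤ L
      · exact Or.inl ⟨hu2, h⟩
      · exact Or.inr ⟨huE, (not_le.1 h).le, huX⟩
    have hfinU : volume (Icc 2 L ∪ (E ∩ Icc L X)) ≠ ⊤ :=
      (measure_union_lt_top (by simp [Real.volume_Icc])
        (measure_lt_top_of_subset inter_subset_right (by simp [Real.volume_Icc]))).ne
    have h1 : volume.real (E ∩ Icc 2 X) ≤ volume.real (Icc (2 : ℝ) L) + volume.real (E ∩ Icc L X) :=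
      (measureReal_mono hsub hfinU).trans (measureReal_union_le _ _)
    rw [Real.volume_real_Icc_of_le hL] at h1
    have hsubL : E ∩ Icc L X ⊆ E ∩ Ici L := inter_subset_inter_right _ Icc_subset_Ici_self
    have hint_L : IntegrableOn (fun u : ℝ => u⁻¹) (E ∩ Ici L) :=
      hint.mono_set (inter_subset_inter_right _ (Ici_subset_Ici.2 hL))
    have hint' : IntegrableOn (fun u : ℝ => u⁻¹) (E ∩ Icc L X) := hint_L.mono_set hsubL
    have hmeas : MeasurableSet (E ∩ Icc L X) := hE.inter measurableSet_Icc
    have hfin : volume (E ∩ Icc L X) ≠ ⊤ :=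
      measure_ne_top_of_subset inter_subset_right (by simp [Real.volume_Icc])
    have h2 : volume.real (E ∩ Icc L X) / X ≤ ∫ u in E ∩ Icc L X, u⁻¹ := by
      calc volume.real (E ∩ Icc L X) / X = ∫ _ in E ∩ Icc L X, (X⁻¹ : ℝ) := by
            rw [setIntegral_const, smul_eq_mul]
            ring
        _ ≤ ∫ u in E ∩ Icc L X, u⁻¹ := by
            refine setIntegral_mono_on ((integrableOn_const_iff).2 (Or.inr hfin.lt_top)) hint' hmeas fun u hu => ?_
            have hLu : L ≤ u := (mem_Icc.1 hu.2).1
            have huX : u ≤ X := (mem_Icc.1 hu.2).2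
            have hu0 : 0 < u := by linarith
            exact inv_anti₀ hu0 huX
    have h3 : (∫ u in E ∩ Icc L X, u⁻¹) ≤ T L := by
      refine setIntegral_mono_set hint_L ?_ hsubL.eventuallyLE
      refine (ae_restrict_iff' (hE.inter measurableSet_Ici)).2 (Eventually.of_forall fun u hu => ?_)
      have hLu : L ≤ u := mem_Ici.1 hu.2
      have : 0 < u := by linarith
      positivity
    calc volume.real (E ∩ Icc 2 X) / X ≤ ((L - 2) + volume.real (E ∩ Icc L X)) / X :=
          div_le_div_of_nonneg_right h1 hX.le
      _ = (L - 2) / X + volume.real (E ∩ Icc L X) / X := by ring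
      _ ≤ (L - 2) / X + T L := by linarith
  -- conclusion
  rw [HasRealNatDensity]
  refine tendsto_order.2 ⟨fun a ha => ?_, fun b hb => ?_⟩
  · filter_upwards [eventually_gt_atTop (0 : ℝ)] with X hX
    exact ha.trans_le (div_nonneg measureReal_nonneg hX.le)
  · obtain ⟨L, hL⟩ := (Filter.eventually_atTop).1
      ((hTlim.eventually (eventually_lt_nhds (show (0 : ℝ) < b / 2 by linarith))).and
        (eventually_ge_atTop (2 : ℝ)))
    have hLT : T L < b / 2 := (hL L le_rfl).1
    have hL2 : 2 ≤ L := (hL L le_rfl).2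
    have hsmall : ∀ᶠ X : ℝ in atTop, (L - 2) / X < b / 2 :=
      (tendsto_const_nhds.div_atTop tendsto_id).eventually (eventually_lt_nhds (by linarith))
    filter_upwards [hsmall, eventually_ge_atTop L] with X h1 h2
    have := hkey L X hL2 h2
    linarith

/-! ## Cor 1.2 from Thm 1.1 — PROVED (the printed deduction at `q = 4`) -/

namespace Hayani2025

/-- `χ₄(3) = −1` for the complex character `χ₄ mod 4`. [folklore] -/
private theorem χ₄C_apply_three :
    (ZMod.χ₄.ringHomComp (Int.castRingHom ℂ) : DirichletCharacter ℂ 4) (3 : ZMod 4) = -1 := by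
  rw [MulChar.ringHomComp_apply]
  have : ZMod.χ₄ (3 : ZMod 4) = -1 := by decide
  rw [this]
  simp

/-- `χ₄(−1) = −1`. [folklore] -/
private theorem χ₄C_apply_neg_one :
    (ZMod.χ₄.ringHomComp (Int.castRingHom ℂ) : DirichletCharacter ℂ 4) (-1 : ZMod 4) = -1 := by
  have : (-1 : ZMod 4) = 3 := by decide
  rw [this, χ₄C_apply_three]

/-- `χ₄ ≠ χ₀`. [folklore] -/
private theorem χ₄C_ne_one : (ZMod.χ₄.ringHomComp (Int.castRingHom ℂ) : DirichletCharacter ℂ 4) ≠ 1 := by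
  intro h
  have h3 := congrArg (fun χ : DirichletCharacter ℂ 4 => χ (3 : ZMod 4)) h
  have hu : IsUnit (3 : ZMod 4) := IsUnit.of_mul_eq_one (3 : ZMod 4) (by decide)
  simp only [χ₄C_apply_three, MulChar.one_apply hu] at h3
  norm_num at h3

/-- Every non-principal character mod `4` is `χ₄` (the units of `ℤ/4ℤ` are `±1`). [folklore] -/
private theorem eq_χ₄C_of_ne_one {χ : DirichletCharacter ℂ 4} (hχ : χ ≠ 1) :
    χ = ZMod.χ₄.ringHomComp (Int.castRingHom ℂ) := by
  have hu : ∀ u : (ZMod 4)ˣ, u = 1 ∨ u = -1 := fun u => by fin_cases u <;> decide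
  have hsq : χ (-1) * χ (-1) = 1 := by rw [← map_mul, neg_one_mul, neg_neg, map_one]
  have hm1 : χ (-1) = -1 := by
    rcases mul_self_eq_one_iff.mp hsq with h1 | h1
    · exfalso
      apply hχ
      apply MulChar.ext
      intro u
      rcases hu u with rfl | rfl
      · rw [Units.val_one, map_one, map_one]
      · rw [MulChar.one_apply_coe, Units.val_neg, Units.val_one, h1]
    · exact h1
  apply MulChar.ext
  intro u
  rcases hu u with rfl | rfl
  · rw [Units.val_one, map_one, map_one]
  · rw [Units.val_neg, Units.val_one, hm1, χ₄C_apply_neg_one]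

/-- The non-principal characters mod `4` are `{χ₄}`. [folklore] -/
private theorem univ_erase_one :
    (Finset.univ : Finset (DirichletCharacter ℂ 4)).erase 1 = {ZMod.χ₄.ringHomComp (Int.castRingHom ℂ)} := by
  ext χ
  simp only [Finset.mem_erase, Finset.mem_univ, and_true, Finset.mem_singleton]
  exact ⟨eq_χ₄C_of_ne_one, fun h => h ▸ χ₄C_ne_one⟩

/-- `r(3) = 0` mod `4` (the squares mod `4` are `0, 1`). [cite: Hayani2025, §1 (Cor 1.2: r(3) < r(1))] -/
theorem sqrtCount_four_three : sqrtCount 4 3 = 0 := by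
  unfold sqrtCount; decide

/-- `r(1) = 2` mod `4` (`1² = 3² = 1`). [cite: Hayani2025, §1 (Cor 1.2: r(3) < r(1))] -/
theorem sqrtCount_four_one : sqrtCount 4 1 = 2 := by
  unfold sqrtCount; decide

/-- **The bias constant at `q = 4`**: `M(4;3,1) = (r(3) − r(1) + 2(χ₄(3) − χ₄(1)) m_{χ₄})/(2φ(4)) = −(1 + 2m_{χ₄})/2`
(`m_{χ₄} = ord_{s=1/2} L(s, χ₄)`; the paper uses it with `m_{χ₄} = 0`, which is known but not needed: `M(4;3,1) < 0` in any
case). [cite: Hayani2025, §1 (display after (1.3)) and Cor 1.2] -/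
theorem biasMean_four_three_one : biasMean 4 3 1 =
    -(1 + 2 * (DirichletDisc.zeroOrder (ZMod.χ₄.ringHomComp (Int.castRingHom ℂ) : DirichletCharacter ℂ 4) (1 / 2) : ℂ))
      / 2 := by
  have hφ : Nat.totient 4 = 2 := by decide
  rw [biasMean, univ_erase_one, Finset.sum_singleton, sqrtCount_four_three, sqrtCount_four_one, hφ, χ₄C_apply_three,
    map_one]
  push_cast
  ring

end Hayani2025

/-- **Cor 1.2, AS PRINTED, proved from Thm 1.1**: «Assume GRH for the non-principal character modulo `4`. Then, the
natural density of the set `𝒫_{1/2}(4;3,1) = {x ≥ 2 : π_{1/2}(x;4,3) > π_{1/2}(x;4,1)}` exists and equals `1`.» — here as a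
consequence `(h : Hayani2025_thm1_1)` (GRH(χ₄)-CONDITIONAL; the printed deduction: «Assuming that `m_χ = 0` for all `χ mod q`, we have
`M(q;a,b) = (r(a) − r(b))/(2φ(q))`. Therefore, if `r(a) < r(b)`, … the natural density of the set `𝒫_{1/2}(q;a,b)` exists and
equals `1`», applied at `q = 4`, `a = 3`, `b = 1` — here without the value of `m_{χ₄}`: `M(4;3,1) = −(1 + 2m_{χ₄})/2 < 0`
always, so on the density-one set of Thm 1.1 (with `ε = 1`) `π_{1/2}(x;4,3) − π_{1/2}(x;4,1) ≥ ½ log log x + Re C − 1 > 0`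
for all large `x`; a superset of a density-one set deprived of a bounded part has density one).
[cite: Hayani2025, Cor 1.2 (and the paragraph before it)] -/
theorem Hayani2025_thm1_1.cor1_2 (h : Hayani2025_thm1_1)
    (hGRH : DirichletCharacter.RiemannHypothesis
      (ZMod.χ₄.ringHomComp (Int.castRingHom ℂ) : DirichletCharacter ℂ 4)) :
    HasRealNatDensity {x : ℝ | 2 ≤ x ∧ primeSumHalf 4 1 x < primeSumHalf 4 3 x} 1 := by
  have hall : ∀ χ : DirichletCharacter ℂ 4, χ ≠ 1 → χ.RiemannHypothesis := fun χ hχ => by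
    rw [Hayani2025.eq_χ₄C_of_ne_one hχ]; exact hGRH
  have h3u : IsUnit (3 : ZMod 4) := IsUnit.of_mul_eq_one (3 : ZMod 4) (by decide)
  obtain ⟨C, hC, -⟩ := h 4 (by norm_num) hall 3 1 h3u isUnit_one (by decide)
  have hA := hC 1 one_pos
  set m : ℕ := DirichletDisc.zeroOrder (ZMod.χ₄.ringHomComp (Int.castRingHom ℂ) : DirichletCharacter ℂ 4) (1 / 2)
    with hm
  have hM : biasMean 4 3 1 = -(1 + 2 * (m : ℂ)) / 2 := Hayani2025.biasMean_four_three_one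
  -- `(log log x)^4/log x → 0` and `log log x → ∞`
  have hδ : Tendsto (fun x : ℝ => Real.log (Real.log x) ^ ((3 : ℝ) + 1) / Real.log x) atTop (𝓝 0) := by
    have h1 := ((isLittleO_log_rpow_rpow_atTop ((3 : ℝ) + 1) one_pos).comp_tendsto
      Real.tendsto_log_atTop).tendsto_div_nhds_zero
    refine h1.congr' (Eventually.of_forall fun x => ?_)
    simp [Real.rpow_one]
  have hLL : Tendsto (fun x : ℝ => Real.log (Real.log x)) atTop atTop :=
    Real.tendsto_log_atTop.comp Real.tendsto_log_atTop
  obtain ⟨x₁, hx₁⟩ := (Filter.eventually_atTop).1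
    ((hδ.eventually (eventually_le_nhds one_pos)).and (hLL.eventually_ge_atTop (2 * ‖C‖ + 4)))
  refine (hA.inter_Ici x₁).of_superset ?_
  rintro x ⟨⟨hx2, hxA⟩, hx1⟩
  obtain ⟨hδx, hLLx⟩ := hx₁ x hx1
  refine ⟨hx2, ?_⟩
  rw [hM] at hxA
  set Δ : ℝ := primeSumHalf 4 3 x - primeSumHalf 4 1 x with hΔ
  set LL : ℝ := Real.log (Real.log x) with hLLdef
  have hre := (Complex.abs_re_le_norm _).trans (hxA.trans hδx)
  have hz : ((Δ : ℂ) + -(1 + 2 * (m : ℂ)) / 2 * (LL : ℂ) - C).re = Δ + -(1 + 2 * (m : ℝ)) / 2 * LL - C.re := by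
    have : (-(1 + 2 * (m : ℂ)) / 2 * (LL : ℂ)) = ((-(1 + 2 * (m : ℝ)) / 2 * LL : ℝ) : ℂ) := by push_cast; ring
    rw [this, Complex.sub_re, ← Complex.ofReal_add, Complex.ofReal_re]
  rw [hz] at hre
  have hCre : |C.re| ≤ ‖C‖ := Complex.abs_re_le_norm C
  have h1 := (abs_le.1 hre).1
  have h2 := (abs_le.1 hCre).1
  have hmnn : (0 : ℝ) ≤ m := Nat.cast_nonneg m
  have hLLpos : 0 ≤ LL := by linarith [norm_nonneg C]
  have hmLL : 0 ≤ (m : ℝ) * LL := mul_nonneg hmnn hLLpos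
  have hΔpos : 0 < Δ := by
    have hexp : -(1 + 2 * (m : ℝ)) / 2 * LL = -(LL / 2) - (m : ℝ) * LL := by ring
    rw [hexp] at h1
    linarith [norm_nonneg C]
  rw [hΔ] at hΔpos
  show primeSumHalf 4 1 x < primeSumHalf 4 3 x
  linarith

end Literature.NumberTheory.LFunctions

end
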